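/-
Copyright (c) 2026 the pub-hodgecm-mathlib formalisation cell (harness21).  Prover seat hodgecm-mathlib-K2E2-p03 (g0),
Track B «K2-LIT» ∕ h413 (stmt-HodgeConjecture-24833), line K2_E2 «ThetaExhaustionByRigidity», unit ORIENT, socket #18 (OR-2) — FILE 3∕4:
Θ-OCC-GEN WITH ORIENTED VALUES — at a negatively oriented place the theta occurrence of an admissible line is ANTIHOLOMORPHIC.  2026-09-03.
KERNEL module: THEOREMS ONLY (no definition, no named fact, no `sorry`, no instance, no notation).
-/
import Summits.HodgeConjecture.HodgeConjecture.Theorems.K2E2OccursClauseAntiholViaPartner   -- file 1∕4: (N9♯) `occursClause_antihol_of_conjPartner_hol`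
import Summits.HodgeConjecture.HodgeConjecture.Theorems.K2E2ThetaOccursInOrientedAdapter    -- file 2∕4: (Ta♯)(Tf) `thetaOccursInClause_of_pinFrame_archFactorOf_antihol∕_hol` (+ ★ GenNeg ∕ GenOriented ∕ ENGINE-GEN ∕ χN-GEN)
import HarnessLib

/-!
# K2_E2 road (h413 = stmt-HodgeConjecture-24833), unit ORIENT, socket #18 (OR-2) — file 3∕4: Θ-OCC-GEN with ORIENTED values

Cell `pub/hodgecm-mathlib` (D-0151), Track B (chair K2-lead, dealer K2E2-plan R8 RE-CUT 2026-09-03T21:42Z), socket `Orient.sig_K2E2OrAntiholWitnessOfNeg`.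
The four orientation cases of the tree's Θ-OCC-GEN (★ `F0P2sThetaOccursInGenOriented` A∕D, ★ `F0P2tThetaOccursInGenNeg` B∕C; split on the canonical
representative `ι₀ := (mk ι).embedding` of the place of `ι`) re-assembled with the value module TRACKED through the oriented adapters of files 1∕4–2∕4
(`Theorems/K2E2OccursClauseAntiholViaPartner.lean`, `Theorems/K2E2ThetaOccursInOrientedAdapter.lean`) — exactly the cases needed at a NEGATIVELY oriented `ι ∉ Φ_μ` ([Liu2021, App. D Lem. D.2 (2)]: the theta lift of a
`Φ_μ`-admissible line has Hodge type `(0,1)` there), plus the HOLOMORPHIC Case A they rest on: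
* §4 `thetaOccursInGenAntihol_caseB` (`ι₀ = ι ∉ Φ_μ`): ★ Case B's proof token for token (★ R3 admissible representative ▸ ENGINE-GEN ★
  `exists_holTheta_atFrame_of_chiN` on the conjugate PARTNER data `(μ′, χ̄, −e, −a′)`, positively oriented, fed by χN-GEN ★ `chiN_gen` ▸ (N9♯) ▸ (Ta♯)(Tf) ▸ ★
  reindex) — values in `(holCotForms [ι,T]).map conjFun`.
* §5 `thetaOccursInGenHol_caseA` (`ι₀ = ι ∈ Φ_μ`): ENGINE-GEN on `(μ, χ, e, a′)` itself ▸ the HOLOMORPHIC adapter ▸ ★ reindex — values in `holCotForms [ι,T]`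
  (★ `thetaOccursInGen_caseA` blurs this to `cohForms`); `thetaOccursInGenAntihol_caseD` (`ι₀ ≠ ι`, `ι ∉ Φ_μ`, so `ι₀ = ῑ ∈ Φ_μ`): §5 Case A at the re-oriented
  frame `(ι₀, T̄)` (★ GenOriented §1) read at `(ι, T)` through the conjugate pull-back ★ `conjFun_comp_mem_holCotForms_of_conj` along `id` — values in
  `(holCotForms [ι,T]).map conjFun`.
* §6 `thetaOccursInGenAntihol_of_not_mem` — `ι ∉ Φ_μ` ⟹ a NON-ZERO `ρ(a,χ)`-equivariant `θ : ω_H(μ,a,χ)[ιV] → (holCotForms [cmArchSection T, cmCompactFactor T]).map conjFun`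
  (`by_cases` on `ι₀ = ι`).  Consumer: file 4∕4 `Theorems/K2E2OrAntiholWitnessOfNeg.lean` (the socket).

HONEST LABEL: HC_CM is proved only modulo the 7 printed citations (2 remaining named inputs: hLiu418 = stmt-HodgeConjecture-24832,
h413 = stmt-HodgeConjecture-24833) until rung 0 closes; this file is a `--supports stmt-HodgeConjecture-24833` helper and discharges no printed citation by
itself — kernel glue over ★ rows.

## References
* [Liu2021] Y. Liu, *Fourier–Jacobi cycles and arithmetic relative trace formula*, Camb. J. Math. 9 (2021) = arXiv:2102.11518: proof of Prop. 4.13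
  (Case 1, l. 2129–2137; «Conversely» l. 2145–2149); Def. 4.11–4.12; App. D §D.1 Steps 1–3, Lem. D.1 (2)–(3) p. 125, Lem. D.2 (2) p. 127.
* [GelbartRogawski1991] S. Gelbart, J. Rogawski, Invent. Math. 105 (1991), §3.1 Prop. 3.1.1 p. 455; Remark p. 457.
* [BorelWallach2000] A. Borel, N. Wallach, 2nd ed. (2000), VII 2.10, 3.2.  [BorelJacquet1979] A. Borel, H. Jacquet, PSPM 33.1 (1979), §4.1, §4.2, §4.6.
* [KonnoKonno2007] T. Konno, K. Konno, Kyushu J. Math. 61 (2007), Thm 5.4.  [PlatonovRapinchuk1994] V. Platonov, A. Rapinchuk (1994), §2.3, §5.1.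
-/

set_option autoImplicit false
-- the mandated namespace repeats the single-problem summit's segment (`HodgeConjecture.HodgeConjecture`)
set_option linter.dupNamespace false

noncomputable section

namespace Summit.HodgeConjecture.HodgeConjecture.Cruxes.H413.K2E2ThetaOccursInGenAntihol


open MulAction NumberField NumberField.InfinitePlace NumberField.mixedEmbedding IsDedekindDomain
open scoped SchwartzMap TensorProduct Classical Matrix ComplexOrder
open Literature.NumberTheory.Automorphic Literature.NumberTheory.Automorphic.UnitaryGroup Literature.NumberTheory.Weil1964
open Literature.NumberTheory.Automorphic.UnitaryGroup.CotangentForms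
open Literature.NumberTheory.Automorphic.IdeleClassGroup
open Literature.Geometry.ComplexHyperbolic.BallModel (U21 x₀)
open Literature.AlgebraicGeometry.ShimuraVarieties
open Literature.AlgebraicGeometry.Motives (CMType)
open Literature.NumberTheory.GelbartRogawski1991 Literature.NumberTheory.GelbartRogawski1991.UnitaryDualPair
open Literature.NumberTheory.GelbartRogawski1991.UnitaryDualPair.WeilCoinv (commute_comp_inl_comp_inr finPairToAdelic finPairRep)
open Literature.NumberTheory.Automorphic.Liu2021 Literature.NumberTheory.Automorphic.Liu2021.Def411WeilCarriers Literature.NumberTheory.Automorphic.Liu2021.Def411WeilCarriersDoubling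
open Literature.NumberTheory.GaloisRepresentations (HeckeCharacter)
open Literature.RepresentationTheory Literature.RepresentationTheory.Liu2021
open Literature.RepresentationTheory.HarrisKudlaSweet1996 (IsSplittingChar)
open HodgeCM HodgeCM.Adelic HodgeCM.PerL34 HodgeCM.Model HodgeCM.Model.ThetaSpace HodgeCM.Model.ArchSideTerm HodgeCM.Model.ThetaAdelicSide
open HodgeCM.Model.ThetaDistFin HodgeCM.Model.HypCensus HodgeCM.Model.LiuIndex HodgeCM.Model.TowerCarrier
open HodgeCM.Model.SupplyResidual.WeilPairData (charInv)
open Literature.Analysis.SegalBargmann (binvPi)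
open Literature.AlgebraicGeometry.ShimuraVarieties (BallForms.isPullbackCocycle_cotangentCocycle BallForms.expP)
open Literature.AlgebraicGeometry.Liu2021 (IsAdmissibleElement isAdmissibleElement_conj_neg_iff)
open Literature.NumberTheory.ComplexMultiplication.CMTypeOps (bar mem_bar_iff coe_bar_eq_setOf_conjugate_mem)
open Summit.HodgeConjecture.CorCM Summit.HodgeConjecture.CorCM.Model Summit.HodgeConjecture.CorCM.Transposition
open Summit.HodgeConjecture.CorCM.Transposition.OmegaChiSplitting (hsChiD)
open Summit.HodgeConjecture.HodgeConjecture.Cruxes.H413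
open Summit.HodgeConjecture.HodgeConjecture.Cruxes.H413.ThetaJunction
open Summit.HodgeConjecture.HodgeConjecture.Cruxes.H413.CohFormsCarriers
open Summit.HodgeConjecture.HodgeConjecture.Cruxes.H413.CuspCot Summit.HodgeConjecture.HodgeConjecture.Cruxes.H413.ThetaDistAtLine Summit.HodgeConjecture.HodgeConjecture.Cruxes.H413.AdmissibleLine
open Summit.HodgeConjecture.HodgeConjecture.Cruxes.H413.F0P2OccGenCotangentOfOccursIn (cmFieldOf hermSpace3Of)
open Summit.HodgeConjecture.HodgeConjecture.Cruxes.H413.F0P3HolProjectionReduction (four_le_finrank_of_two_le)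
open Summit.HodgeConjecture.HodgeConjecture.Cruxes.H413.F0P2sThetaOccursInFrameTransport
open Summit.HodgeConjecture.HodgeConjecture.Cruxes.H413.F0P2sThetaOccursInArchTransport
open Summit.HodgeConjecture.HodgeConjecture.Cruxes.H413.F0P2sThetaOccursInGenOriented
open Literature.NumberTheory.Automorphic.UnitaryGroup.CotangentForms
open Literature.Geometry.ComplexHyperbolic NumberField.InfinitePlace
open Literature.Geometry.ComplexHyperbolic.BallModel (U21 x₀ conjU21 mat)

open Summit.HodgeConjecture.HodgeConjecture.Cruxes.H413.F0P2tThetaOccursInGenNeg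
open Literature.NumberTheory.ComplexMultiplication.CMTypeOps (conjugate_mem_iff_notMem)


open Summit.HodgeConjecture.HodgeConjecture.Cruxes.H413.K2E2OccursClauseAntiholViaPartner (occursClause_antihol_of_conjPartner_hol)
open Summit.HodgeConjecture.HodgeConjecture.Cruxes.H413.K2E2ThetaOccursInOrientedAdapter

/-! ## §4 Case B: `(mk ι).embedding = ι ∉ Φ_μ` — the partner is positively oriented at the SAME packaged frame -/

set_option synthInstance.maxHeartbeats 400000 in
set_option maxHeartbeats 16000000 in
/-- **Θ-OCC-GEN, CASE B (`(mk ι).embedding = ι`, `ι ∉ Φ_μ`), ANTIHOLOMORPHIC VALUES RECORDED** (★ `F0P2tThetaOccursInGenNeg.thetaOccursInGen_caseB`'s proof token for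
token over the sharpened §2–§3: the clause's `θ` is valued in `(holCotForms [ι,T]).map conjFun`).  ★ R3 (admissible representative `a′ = e·2δ`) ▸ for EVERY partner `μ′`
(weight one, `HasCMType μ′ Φ̄_μ`, so `ι ∈ Φ_(μ′)` and `−e` is `Φ_(μ′)`-admissible with `−a′ = (−e)·2δ`): ENGINE-GEN ★ `exists_holTheta_atFrame_of_chiN` at
`(cmFieldOf L, hermSpace3Of …, μ′, χ̄, −e, −a′)` fed by ★ (N8) `chiN_gen` ▸ ★ (N9) `occursClause_cohForms_of_conjPartner_hol` ▸ §1 ▸ ★ `thetaOccursInClause_of_reindex`.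
[cite: Liu2021, Prop. 4.13 («Conversely» l. 2145–2149); Def. 4.12 (last sentence); App. D Lem. D.1 (2) (l. 5231), Lem. D.2 (2)]
[cite: GelbartRogawski1991, §3.1 Prop. 3.1.1 p. 455; Remark p. 457 L4–13] [cite: Li1992, Thm 2.1 (26) p. 184] [cite: KonnoKonno2007, Thm 5.4] -/
theorem thetaOccursInGenAntihol_caseB :
  ∀ (L : Type) [Field L] [NumberField L] [IsCMField L] (ι : L →+* ℂ) (H : Matrix (Fin 3) (Fin 3) L) (T : GL (Fin 3) ℂ)
    (hT : (T : Matrix (Fin 3) (Fin 3) ℂ)ᴴ * H.map ι * (T : Matrix (Fin 3) (Fin 3) ℂ) = Literature.Geometry.ComplexHyperbolic.BallModel.J),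
    (∀ τ' : L →+* ℂ, InfinitePlace.mk τ' ≠ InfinitePlace.mk ι → (H.map τ').PosDef) → 2 ≤ Module.finrank ℚ ↥(maximalRealSubfield L) →
    ∀ {n' : ℕ} (e₁ : Fin 3 × Fin 1 ≃ Fin n') (dV : Fin 3 → L) (hdV : ∀ i, IsCMField.complexConj L (dV i) = dV i)
      (hdV0 : ∀ i, dV i ≠ 0) (g : GL (Fin 3) L)
      (hg : ((g : Matrix (Fin 3) (Fin 3) L).map (cmConjRingHom L))ᵀ * H * (g : Matrix (Fin 3) (Fin 3) L) = Matrix.diagonal dV)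
      (ιV : finAdelic (↥(maximalRealSubfield L)) L (IsCMField.complexConj L) 3 H →*
          finAdelic (↥(maximalRealSubfield L)) L (IsCMField.complexConj L) 3 (Matrix.diagonal dV)),
        (∀ k, ((ιV k : finAdelic (↥(maximalRealSubfield L)) L (IsCMField.complexConj L) 3 (Matrix.diagonal dV)) :
            GL (Fin 3) (FiniteAdeleRing (𝓞 L) L)) =
          (toFinAdeleGL L 3 g)⁻¹ * (k : GL (Fin 3) (FiniteAdeleRing (𝓞 L) L)) * toFinAdeleGL L 3 g) →
        ∀ (μ : Literature.NumberTheory.Automorphic.IdeleClassGroup L →ₜ* Circle) (hμ : IsConjugateSymplectic L μ), HasWeight L μ 1 →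
          ∀ (a : (↥(maximalRealSubfield L))ˣ) (χ : Chi (↥(maximalRealSubfield L)) L (IsCMField.complexConj L)),
            (∃ e : L, IsAdmissibleElement L hμ.cmType.1 e ∧
                epsOf (↥(maximalRealSubfield L)) (imagUnitSq L) L (2 * imagUnit L)⁻¹ e = locF (↥(maximalRealSubfield L)) (imagUnitSq L) a) →
              (InfinitePlace.mk ι).embedding = ι → ι ∉ hμ.cmType.1 →
              ∃ θ : (omegaAtLine (↥(maximalRealSubfield L)) L (IsCMField.complexConj L) 3 e₁ (Matrix.diagonal dV)
                      (complexConj_imagUnit L) (imagUnit_ne_zero L) (imagUnit_mul_self L) (realDiagonal_isSymm L dV hdV)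
                      (isUnit_det_realDiagonal L dV hdV hdV0) (realDiagonal_map L dV hdV).symm
                      (fun a => isCompatible_chiSplittingLine L e₁ dV hdV hdV0 (toHeckeCharacter L μ)
                        (isUnitary_toHeckeCharacter L μ) ((isOscillatorChar_toHeckeCharacter_iff μ).mpr hμ)
                        (TW (↥(maximalRealSubfield L)) a) (isSymm_TW (↥(maximalRealSubfield L)) a)
                        (isUnit_det_TW (↥(maximalRealSubfield L)) a) (JW (↥(maximalRealSubfield L)) L a)
                        (JW_eq (↥(maximalRealSubfield L)) L a)) a χ) →ₗ[ℂ]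
                    ((adelicGroupData (↥(maximalRealSubfield L)) L (IsCMField.complexConj L) 3 H).Adelic → (Fin 2 → ℂ)),
                θ ≠ 0 ∧
                (∀ w, θ w ∈ (CotangentForms.holCotForms (↥(maximalRealSubfield L)) L (IsCMField.complexConj L) 3 H
                    (cmArchSection L ι H T hT) (cmCompactFactor L ι H T hT)).map
                    (CotangentForms.conjFun (↥(maximalRealSubfield L)) L (IsCMField.complexConj L) 3 H)) ∧
                ∀ (k : ↥(finAdelic (↥(maximalRealSubfield L)) L (IsCMField.complexConj L) 3 H)) w,
                  θ (rhoAtLine (↥(maximalRealSubfield L)) L (IsCMField.complexConj L) 3 e₁ (Matrix.diagonal dV)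
                      (complexConj_imagUnit L) (imagUnit_ne_zero L) (imagUnit_mul_self L) (realDiagonal_isSymm L dV hdV)
                      (isUnit_det_realDiagonal L dV hdV hdV0) (realDiagonal_map L dV hdV).symm
                      (fun a => isCompatible_chiSplittingLine L e₁ dV hdV hdV0 (toHeckeCharacter L μ)
                        (isUnitary_toHeckeCharacter L μ) ((isOscillatorChar_toHeckeCharacter_iff μ).mpr hμ)
                        (TW (↥(maximalRealSubfield L)) a) (isSymm_TW (↥(maximalRealSubfield L)) a)
                        (isUnit_det_TW (↥(maximalRealSubfield L)) a) (JW (↥(maximalRealSubfield L)) L a)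
                        (JW_eq (↥(maximalRealSubfield L)) L a)) ιV a χ k w) =
                    fun x => θ w (x * finAdelicToAdelic (↥(maximalRealSubfield L)) L (IsCMField.complexConj L) 3 H k)
 := by
  intro L _ _ _ ι H T hT hHpos h2 n' eV dV hdV hdV0 g hg ιV hιV μ hμ hw a χ hadm hemb hnot
  -- (a′): reduce to an admissible representative `a′ = e · 2δ_L` of the collection `locF a` (★ R3)
  refine F0P2sThetaOccursInLineTransport.thetaOccursInClause_of_admissibleRepresentative L 3 H eV dV hdV hdV0 ιV μ hμ χ _
    hμ.cmType.1 a hadm fun e he a' hae => ?_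
  -- (An) and the field-degree guard
  have h4 : 4 ≤ Module.finrank ℚ L := four_le_finrank_of_two_le (L := L) h2
  have hV : IsAnisotropic (cmFieldOf L) (HodgeCM.HermSpace3.Hm (hermSpace3Of L ι H T hT hHpos)) :=
    (HodgeCM.HermSpace3.isAnisotropic_iff_finrank_ne_two (hermSpace3Of L ι H T hT hHpos)).2 (by
      show Module.finrank ℚ L ≠ 2
      omega)
  -- the PARTNER ROAD at the packaged frame: the ANTIHOLOMORPHIC clause for `ω(μ, ⟨a′⟩, χ)` with values in `conj holCotForms (archFactorOf F V)` (§2)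
  have hcoh := occursClause_antihol_of_conjPartner_hol (L := cmFieldOf L)
    (hermSpace3Of L ι H T hT hHpos) μ hμ hw hμ.hasCMType_cmType a' χ (fun μ' hμ' hw' hΦ' => by
      -- the partner is positively oriented: `Φ_(μ′) = Φ̄_μ ∋ ι`
      have hcm : hμ'.cmType = bar hμ.cmType := hμ'.cmType_eq hΦ'
      have hι' : ι ∈ hμ'.cmType.1 := by
        rw [hcm]
        exact (mem_bar_iff _ _).2 hnot
      -- `−e` is `Φ_(μ′)`-admissible and `−a′ = (−e) · 2δ_L`
      have he' : IsAdmissibleElement L hμ'.cmType.1 (-e) := by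
        rw [hcm, coe_bar_eq_setOf_conjugate_mem]
        exact (isAdmissibleElement_conj_neg_iff _ _).2 he
      have hae' : (((-a' : (↥(maximalRealSubfield L))ˣ) : ↥(maximalRealSubfield L)) : L) = (-e) * (2 * imagUnit L) := by
        rw [Units.val_neg]
        push_cast
        rw [hae]
        ring
      -- ENGINE-GEN on the partner data, fed by χN-GEN (N8)
      exact F0P2sThetaOccursInEngineGen.exists_holTheta_atFrame_of_chiN (cmFieldOf L) (hermSpace3Of L ι H T hT hHpos) hV hemb
        hμ'.cmType μ' hμ' hw' hι' _ (-e) (-a') he' hae'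
        (F0P2tChiNGenHolds.chiN_gen (cmFieldOf L) (hermSpace3Of L ι H T hT hHpos) h4 hμ'.cmType μ' hμ' hw'
          (by rw [hemb]; exact hι') _ (-e) (-a') he' hae'))
  -- §3: to the letter's frame `(dV, g, ιV)` and `conj holCotForms (cmArchSection, cmCompactFactor)`, at the model enumeration
  have hA := thetaOccursInClause_of_pinFrame_archFactorOf_antihol (cmFieldOf L) (hermSpace3Of L ι H T hT hHpos) T hT
    HodgeCM.Model.ArchSideTerm.e₁ dV hdV hdV0 g hg ιV hιV μ hμ a' χ hcoh
  -- the letter's enumeration `eV`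
  exact F0P2sThetaOccursInOfEngine.thetaOccursInClause_of_reindex L 3 H eV HodgeCM.Model.ArchSideTerm.e₁ dV hdV hdV0 ιV μ hμ a' χ _ hA


/-! ## §5 Case A with HOLOMORPHIC values recorded, and Case D at a negatively oriented `ι` (antiholomorphic values) -/

set_option synthInstance.maxHeartbeats 400000 in
set_option maxHeartbeats 16000000 in
-- heartbeats: the carriers `omegaAtLine … (isCompatible_chiSplittingLine …)` elaborate the χ-attached splitting datum (same budget as ★ `thetaOccursInGen_caseB`).
/-- **Θ-OCC-GEN, CASE A (`(mk ι).embedding = ι ∈ Φ_μ`), HOLOMORPHIC VALUES RECORDED**: ★ R3 (admissible representative `a′ = e·2δ_L`) ▸ ENGINE-GEN ★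
`exists_holTheta_atFrame_of_chiN` at `(cmFieldOf L, hermSpace3Of …, μ, χ, e, a′)` fed by χN-GEN ★ `chiN_gen` (the holomorphic clause at the pin frame, values in
`holCotForms (archFactorOf …)`) ▸ §3 (holomorphic adapter) ▸ ★ `thetaOccursInClause_of_reindex`.  (★ `F0P2sThetaOccursInGenOriented.thetaOccursInGen_caseA` is the
same with the conclusion blurred to `cohForms`.)
[cite: Liu2021, Prop. 4.13 («Conversely» l. 2145–2149); Def. 4.12; App. D §D.1 Steps 1–3, Lem. D.2 (2)] [cite: GelbartRogawski1991, §3.1 Prop. 3.1.1 p. 455; Remark p. 457 L4–13]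
[cite: KonnoKonno2007, Thm 5.4] -/

theorem thetaOccursInGenHol_caseA :
  ∀ (L : Type) [Field L] [NumberField L] [IsCMField L] (ι : L →+* ℂ) (H : Matrix (Fin 3) (Fin 3) L) (T : GL (Fin 3) ℂ)
    (hT : (T : Matrix (Fin 3) (Fin 3) ℂ)ᴴ * H.map ι * (T : Matrix (Fin 3) (Fin 3) ℂ) = Literature.Geometry.ComplexHyperbolic.BallModel.J),
    (∀ τ' : L →+* ℂ, InfinitePlace.mk τ' ≠ InfinitePlace.mk ι → (H.map τ').PosDef) → 2 ≤ Module.finrank ℚ ↥(maximalRealSubfield L) →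
    ∀ {n' : ℕ} (e₁ : Fin 3 × Fin 1 ≃ Fin n') (dV : Fin 3 → L) (hdV : ∀ i, IsCMField.complexConj L (dV i) = dV i)
      (hdV0 : ∀ i, dV i ≠ 0) (g : GL (Fin 3) L)
      (hg : ((g : Matrix (Fin 3) (Fin 3) L).map (cmConjRingHom L))ᵀ * H * (g : Matrix (Fin 3) (Fin 3) L) = Matrix.diagonal dV)
      (ιV : finAdelic (↥(maximalRealSubfield L)) L (IsCMField.complexConj L) 3 H →*
          finAdelic (↥(maximalRealSubfield L)) L (IsCMField.complexConj L) 3 (Matrix.diagonal dV)),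
        (∀ k, ((ιV k : finAdelic (↥(maximalRealSubfield L)) L (IsCMField.complexConj L) 3 (Matrix.diagonal dV)) :
            GL (Fin 3) (FiniteAdeleRing (𝓞 L) L)) =
          (toFinAdeleGL L 3 g)⁻¹ * (k : GL (Fin 3) (FiniteAdeleRing (𝓞 L) L)) * toFinAdeleGL L 3 g) →
        ∀ (μ : Literature.NumberTheory.Automorphic.IdeleClassGroup L →ₜ* Circle) (hμ : IsConjugateSymplectic L μ), HasWeight L μ 1 →
          ∀ (a : (↥(maximalRealSubfield L))ˣ) (χ : Chi (↥(maximalRealSubfield L)) L (IsCMField.complexConj L)),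
            (∃ e : L, IsAdmissibleElement L hμ.cmType.1 e ∧
                epsOf (↥(maximalRealSubfield L)) (imagUnitSq L) L (2 * imagUnit L)⁻¹ e = locF (↥(maximalRealSubfield L)) (imagUnitSq L) a) →
              (InfinitePlace.mk ι).embedding = ι → ι ∈ hμ.cmType.1 →
              ∃ θ : (omegaAtLine (↥(maximalRealSubfield L)) L (IsCMField.complexConj L) 3 e₁ (Matrix.diagonal dV)
                      (complexConj_imagUnit L) (imagUnit_ne_zero L) (imagUnit_mul_self L) (realDiagonal_isSymm L dV hdV)
                      (isUnit_det_realDiagonal L dV hdV hdV0) (realDiagonal_map L dV hdV).symm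
                      (fun a => isCompatible_chiSplittingLine L e₁ dV hdV hdV0 (toHeckeCharacter L μ)
                        (isUnitary_toHeckeCharacter L μ) ((isOscillatorChar_toHeckeCharacter_iff μ).mpr hμ)
                        (TW (↥(maximalRealSubfield L)) a) (isSymm_TW (↥(maximalRealSubfield L)) a)
                        (isUnit_det_TW (↥(maximalRealSubfield L)) a) (JW (↥(maximalRealSubfield L)) L a)
                        (JW_eq (↥(maximalRealSubfield L)) L a)) a χ) →ₗ[ℂ]
                    ((adelicGroupData (↥(maximalRealSubfield L)) L (IsCMField.complexConj L) 3 H).Adelic → (Fin 2 → ℂ)),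
                θ ≠ 0 ∧
                (∀ w, θ w ∈ CotangentForms.holCotForms (↥(maximalRealSubfield L)) L (IsCMField.complexConj L) 3 H
                    (cmArchSection L ι H T hT) (cmCompactFactor L ι H T hT)) ∧
                ∀ (k : ↥(finAdelic (↥(maximalRealSubfield L)) L (IsCMField.complexConj L) 3 H)) w,
                  θ (rhoAtLine (↥(maximalRealSubfield L)) L (IsCMField.complexConj L) 3 e₁ (Matrix.diagonal dV)
                      (complexConj_imagUnit L) (imagUnit_ne_zero L) (imagUnit_mul_self L) (realDiagonal_isSymm L dV hdV)
                      (isUnit_det_realDiagonal L dV hdV hdV0) (realDiagonal_map L dV hdV).symm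
                      (fun a => isCompatible_chiSplittingLine L e₁ dV hdV hdV0 (toHeckeCharacter L μ)
                        (isUnitary_toHeckeCharacter L μ) ((isOscillatorChar_toHeckeCharacter_iff μ).mpr hμ)
                        (TW (↥(maximalRealSubfield L)) a) (isSymm_TW (↥(maximalRealSubfield L)) a)
                        (isUnit_det_TW (↥(maximalRealSubfield L)) a) (JW (↥(maximalRealSubfield L)) L a)
                        (JW_eq (↥(maximalRealSubfield L)) L a)) ιV a χ k w) =
                    fun x => θ w (x * finAdelicToAdelic (↥(maximalRealSubfield L)) L (IsCMField.complexConj L) 3 H k)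

 := by
  intro L _ _ _ ι H T hT hHpos h2 n' eV dV hdV hdV0 g hg ιV hιV μ hμ hw a χ hadm hemb hι
  -- (a′): reduce to an admissible representative `a′ = e · 2δ_L` of the collection `locF a` (★ R3)
  refine F0P2sThetaOccursInLineTransport.thetaOccursInClause_of_admissibleRepresentative L 3 H eV dV hdV hdV0 ιV μ hμ χ _
    hμ.cmType.1 a hadm fun e he a' hae => ?_
  -- (An) and the field-degree guard
  have h4 : 4 ≤ Module.finrank ℚ L := four_le_finrank_of_two_le (L := L) h2
  have hV : IsAnisotropic (cmFieldOf L) (HodgeCM.HermSpace3.Hm (hermSpace3Of L ι H T hT hHpos)) :=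
    (HodgeCM.HermSpace3.isAnisotropic_iff_finrank_ne_two (hermSpace3Of L ι H T hT hHpos)).2 (by
      show Module.finrank ℚ L ≠ 2
      omega)
  -- ENGINE-GEN on `(μ, χ, e, a′)` itself (positively oriented), fed by χN-GEN (N8): the HOLOMORPHIC clause at the pin frame
  have hhol := F0P2sThetaOccursInEngineGen.exists_holTheta_atFrame_of_chiN (cmFieldOf L) (hermSpace3Of L ι H T hT hHpos) hV hemb
    hμ.cmType μ hμ hw hι χ e a' he hae
    (F0P2tChiNGenHolds.chiN_gen (cmFieldOf L) (hermSpace3Of L ι H T hT hHpos) h4 hμ.cmType μ hμ hw (by rw [hemb]; exact hι) χ e a' he hae)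
  -- §3 (holomorphic adapter): to the letter's frame `(dV, g, ιV)` and `holCotForms (cmArchSection, cmCompactFactor)`, at the model enumeration
  have hA := thetaOccursInClause_of_pinFrame_archFactorOf_hol (cmFieldOf L) (hermSpace3Of L ι H T hT hHpos) T hT
    HodgeCM.Model.ArchSideTerm.e₁ dV hdV hdV0 g hg ιV hιV μ hμ a' χ hhol
  -- the letter's enumeration `eV`
  exact F0P2sThetaOccursInOfEngine.thetaOccursInClause_of_reindex L 3 H eV HodgeCM.Model.ArchSideTerm.e₁ dV hdV hdV0 ιV μ hμ a' χ _ hA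


set_option synthInstance.maxHeartbeats 400000 in
set_option maxHeartbeats 8000000 in
/-- **Θ-OCC-GEN, CASE D at a NEGATIVELY oriented `ι` (`ι₀ := (mk ι).embedding ≠ ι`, `ι ∉ Φ_μ`, hence `ι₀ = ῑ ∈ Φ_μ`), ANTIHOLOMORPHIC VALUES RECORDED**:
§5 Case A at the re-oriented frame `(ι₀, T̄)` (★ GenOriented §1: `T̄` is a frame at `ι₀`, `(mk ι₀).embedding = ι₀`, `H` definite off the place) yields `θ` valued in
`holCotForms (cmArchSection L ι₀ H T̄) (cmCompactFactor …)`; since `cmArchSection L ι H T = cmArchSection L ι₀ H T̄ ∘ conjU21` (★ `cmArchSection_eq_conjU21`) and the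
compact factors agree (★ `cmCompactFactor_eq_of_embedding`), the conjugate pull-back ★ `conjFun_comp_mem_holCotForms_of_conj` along `κ := id` shows
`conjFun (θ w) ∈ holCotForms (cmArchSection L ι H T) (cmCompactFactor …)`, i.e. `θ w = conjFun (conjFun (θ w))` lies in the ANTIHOLOMORPHIC summand at `(ι, T)`;
`θ` itself is unchanged (★ `thetaOccursInGen_caseD`'s proof with the value module tracked).
[cite: Liu2021, Prop. 4.13 («Conversely» l. 2145–2149); App. D Lem. D.2 (2)] [cite: BorelWallach2000, VII 2.10] [cite: BorelJacquet1979, §4.1] -/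

theorem thetaOccursInGenAntihol_caseD :
  ∀ (L : Type) [Field L] [NumberField L] [IsCMField L] (ι : L →+* ℂ) (H : Matrix (Fin 3) (Fin 3) L) (T : GL (Fin 3) ℂ)
    (hT : (T : Matrix (Fin 3) (Fin 3) ℂ)ᴴ * H.map ι * (T : Matrix (Fin 3) (Fin 3) ℂ) = Literature.Geometry.ComplexHyperbolic.BallModel.J),
    (∀ τ' : L →+* ℂ, InfinitePlace.mk τ' ≠ InfinitePlace.mk ι → (H.map τ').PosDef) → 2 ≤ Module.finrank ℚ ↥(maximalRealSubfield L) →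
    ∀ {n' : ℕ} (e₁ : Fin 3 × Fin 1 ≃ Fin n') (dV : Fin 3 → L) (hdV : ∀ i, IsCMField.complexConj L (dV i) = dV i)
      (hdV0 : ∀ i, dV i ≠ 0) (g : GL (Fin 3) L)
      (hg : ((g : Matrix (Fin 3) (Fin 3) L).map (cmConjRingHom L))ᵀ * H * (g : Matrix (Fin 3) (Fin 3) L) = Matrix.diagonal dV)
      (ιV : finAdelic (↥(maximalRealSubfield L)) L (IsCMField.complexConj L) 3 H →*
          finAdelic (↥(maximalRealSubfield L)) L (IsCMField.complexConj L) 3 (Matrix.diagonal dV)),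
        (∀ k, ((ιV k : finAdelic (↥(maximalRealSubfield L)) L (IsCMField.complexConj L) 3 (Matrix.diagonal dV)) :
            GL (Fin 3) (FiniteAdeleRing (𝓞 L) L)) =
          (toFinAdeleGL L 3 g)⁻¹ * (k : GL (Fin 3) (FiniteAdeleRing (𝓞 L) L)) * toFinAdeleGL L 3 g) →
        ∀ (μ : Literature.NumberTheory.Automorphic.IdeleClassGroup L →ₜ* Circle) (hμ : IsConjugateSymplectic L μ), HasWeight L μ 1 →
          ∀ (a : (↥(maximalRealSubfield L))ˣ) (χ : Chi (↥(maximalRealSubfield L)) L (IsCMField.complexConj L)),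
            (∃ e : L, IsAdmissibleElement L hμ.cmType.1 e ∧
                epsOf (↥(maximalRealSubfield L)) (imagUnitSq L) L (2 * imagUnit L)⁻¹ e = locF (↥(maximalRealSubfield L)) (imagUnitSq L) a) →
              (InfinitePlace.mk ι).embedding ≠ ι → ι ∉ hμ.cmType.1 →
              ∃ θ : (omegaAtLine (↥(maximalRealSubfield L)) L (IsCMField.complexConj L) 3 e₁ (Matrix.diagonal dV)
                      (complexConj_imagUnit L) (imagUnit_ne_zero L) (imagUnit_mul_self L) (realDiagonal_isSymm L dV hdV)
                      (isUnit_det_realDiagonal L dV hdV hdV0) (realDiagonal_map L dV hdV).symm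
                      (fun a => isCompatible_chiSplittingLine L e₁ dV hdV hdV0 (toHeckeCharacter L μ)
                        (isUnitary_toHeckeCharacter L μ) ((isOscillatorChar_toHeckeCharacter_iff μ).mpr hμ)
                        (TW (↥(maximalRealSubfield L)) a) (isSymm_TW (↥(maximalRealSubfield L)) a)
                        (isUnit_det_TW (↥(maximalRealSubfield L)) a) (JW (↥(maximalRealSubfield L)) L a)
                        (JW_eq (↥(maximalRealSubfield L)) L a)) a χ) →ₗ[ℂ]
                    ((adelicGroupData (↥(maximalRealSubfield L)) L (IsCMField.complexConj L) 3 H).Adelic → (Fin 2 → ℂ)),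
                θ ≠ 0 ∧
                (∀ w, θ w ∈ (CotangentForms.holCotForms (↥(maximalRealSubfield L)) L (IsCMField.complexConj L) 3 H
                    (cmArchSection L ι H T hT) (cmCompactFactor L ι H T hT)).map
                    (CotangentForms.conjFun (↥(maximalRealSubfield L)) L (IsCMField.complexConj L) 3 H)) ∧
                ∀ (k : ↥(finAdelic (↥(maximalRealSubfield L)) L (IsCMField.complexConj L) 3 H)) w,
                  θ (rhoAtLine (↥(maximalRealSubfield L)) L (IsCMField.complexConj L) 3 e₁ (Matrix.diagonal dV)
                      (complexConj_imagUnit L) (imagUnit_ne_zero L) (imagUnit_mul_self L) (realDiagonal_isSymm L dV hdV)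
                      (isUnit_det_realDiagonal L dV hdV hdV0) (realDiagonal_map L dV hdV).symm
                      (fun a => isCompatible_chiSplittingLine L e₁ dV hdV hdV0 (toHeckeCharacter L μ)
                        (isUnitary_toHeckeCharacter L μ) ((isOscillatorChar_toHeckeCharacter_iff μ).mpr hμ)
                        (TW (↥(maximalRealSubfield L)) a) (isSymm_TW (↥(maximalRealSubfield L)) a)
                        (isUnit_det_TW (↥(maximalRealSubfield L)) a) (JW (↥(maximalRealSubfield L)) L a)
                        (JW_eq (↥(maximalRealSubfield L)) L a)) ιV a χ k w) =
                    fun x => θ w (x * finAdelicToAdelic (↥(maximalRealSubfield L)) L (IsCMField.complexConj L) 3 H k)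

 := by
  intro L _ _ _ ι H T hT hHpos h2 n' eV dV hdV hdV0 g hg ιV hιV μ hμ hw a χ hadm hne hnot
  -- the re-oriented frame `(ι₀, T̄)` at the canonical representative `ι₀ := (mk ι).embedding = ῑ`, which IS in `Φ_μ`
  have hT₀ := conjTranspose_conjFrame_mul L ι H T hT hne
  have hemb₀ : (InfinitePlace.mk (InfinitePlace.mk ι).embedding).embedding = (InfinitePlace.mk ι).embedding := by rw [InfinitePlace.mk_embedding]
  have hmem₀ : (InfinitePlace.mk ι).embedding ∈ hμ.cmType.1 := by
    rw [(NumberField.InfinitePlace.embedding_mk_eq ι).resolve_left hne]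
    exact (conjugate_mem_iff_notMem hμ.cmType ι).2 hnot
  obtain ⟨θ, hθ0, hθA, hθσ⟩ := thetaOccursInGenHol_caseA L (InfinitePlace.mk ι).embedding H (Matrix.GeneralLinearGroup.map (starRingEnd ℂ) T) hT₀
    (posDef_off_embedding L ι H hHpos) h2 eV dV hdV hdV0 g hg ιV hιV μ hμ hw a χ hadm hemb₀ hmem₀
  refine ⟨θ, hθ0, fun w => ?_, hθσ⟩
  -- values: `holCotForms (ι₀, T̄) ∋ θ w`, so `conjFun ((θ w) ∘ id) ∈ holCotForms (ι, T)` by the conjugate pull-back along `id`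
  have hrel : ∀ u : U21, (MonoidHom.id (adelicGroupData (↥(maximalRealSubfield L)) L (IsCMField.complexConj L) 3 H).Adelic) (cmArchSection L ι H T hT u) =
      cmArchSection L (InfinitePlace.mk ι).embedding H (Matrix.GeneralLinearGroup.map (starRingEnd ℂ) T) hT₀ (conjU21 u) := fun u => by
    rw [MonoidHom.id_apply]; exact cmArchSection_eq_conjU21 L ι H T hT hne hT₀ u
  have hK : ∀ k ∈ cmCompactFactor L ι H T hT, (MonoidHom.id _) k ∈ cmCompactFactor L (InfinitePlace.mk ι).embedding H (Matrix.GeneralLinearGroup.map (starRingEnd ℂ) T) hT₀ :=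
    fun k hk => by rw [MonoidHom.id_apply, ← cmCompactFactor_eq_of_embedding L ι H T hT _ hT₀]; exact hk
  have hconj : CotangentForms.conjFun (↥(maximalRealSubfield L)) L (IsCMField.complexConj L) 3 H (fun x => θ w ((MonoidHom.id _) x)) ∈
      CotangentForms.holCotForms (↥(maximalRealSubfield L)) L (IsCMField.complexConj L) 3 H (cmArchSection L ι H T hT) (cmCompactFactor L ι H T hT) :=
    conjFun_comp_mem_holCotForms_of_conj (κ := MonoidHom.id _) (κf := MonoidHom.id _) hrel (fun γ hγ => hγ) hK (fun g => rfl) continuous_id (hθA w)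
  refine Submodule.mem_map.2 ⟨_, hconj, ?_⟩
  funext x
  rw [CotangentForms.conjFun_apply, CotangentForms.conjFun_apply, star_star, MonoidHom.id_apply]


/-! ## §6 The antiholomorphic clause at every negatively oriented CM frame -/

set_option synthInstance.maxHeartbeats 400000 in
set_option maxHeartbeats 8000000 in
/-- **Θ-OCC-GEN at `ι ∉ Φ_μ`, ANTIHOLOMORPHIC VALUES**: for a CM frame `(L, ι, H, T)`, a rational frame `(e₁, dV, g, ιV)`, a conjugate-symplectic weight-one `μ` with
`ι ∉ Φ_μ`, a line `a` with admissible collection and `χ ∈ Chi`: a NON-ZERO `ρ(a,χ)`-equivariant linear `θ : ω_H(μ,a,χ)[ιV] → (U(H)(𝔸) → ℂ²)` valued in the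
ANTIHOLOMORPHIC cotangent forms `(holCotForms (cmArchSection T) (cmCompactFactor T)).map conjFun` — `by_cases` on the embedding normalisation: §4 Case B
(`(mk ι).embedding = ι`, partner road) or §5 Case D (`(mk ι).embedding = ῑ`, conjugate pull-back).  [Liu2021, Lem. D.2 (2)]: at a negatively oriented place the
theta lift of a `Φ_μ`-admissible line is of Hodge type `(0,1)`.
[cite: Liu2021, Prop. 4.13 («Conversely» l. 2145–2149); App. D Lem. D.1 (2) (l. 5231), Lem. D.2 (2) p. 127] [cite: GelbartRogawski1991, §3.1 Prop. 3.1.1 p. 455]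
[cite: BorelWallach2000, VII 2.10] -/

theorem thetaOccursInGenAntihol_of_not_mem :
  ∀ (L : Type) [Field L] [NumberField L] [IsCMField L] (ι : L →+* ℂ) (H : Matrix (Fin 3) (Fin 3) L) (T : GL (Fin 3) ℂ)
    (hT : (T : Matrix (Fin 3) (Fin 3) ℂ)ᴴ * H.map ι * (T : Matrix (Fin 3) (Fin 3) ℂ) = Literature.Geometry.ComplexHyperbolic.BallModel.J),
    (∀ τ' : L →+* ℂ, InfinitePlace.mk τ' ≠ InfinitePlace.mk ι → (H.map τ').PosDef) → 2 ≤ Module.finrank ℚ ↥(maximalRealSubfield L) →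
    ∀ {n' : ℕ} (e₁ : Fin 3 × Fin 1 ≃ Fin n') (dV : Fin 3 → L) (hdV : ∀ i, IsCMField.complexConj L (dV i) = dV i)
      (hdV0 : ∀ i, dV i ≠ 0) (g : GL (Fin 3) L)
      (hg : ((g : Matrix (Fin 3) (Fin 3) L).map (cmConjRingHom L))ᵀ * H * (g : Matrix (Fin 3) (Fin 3) L) = Matrix.diagonal dV)
      (ιV : finAdelic (↥(maximalRealSubfield L)) L (IsCMField.complexConj L) 3 H →*
          finAdelic (↥(maximalRealSubfield L)) L (IsCMField.complexConj L) 3 (Matrix.diagonal dV)),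
        (∀ k, ((ιV k : finAdelic (↥(maximalRealSubfield L)) L (IsCMField.complexConj L) 3 (Matrix.diagonal dV)) :
            GL (Fin 3) (FiniteAdeleRing (𝓞 L) L)) =
          (toFinAdeleGL L 3 g)⁻¹ * (k : GL (Fin 3) (FiniteAdeleRing (𝓞 L) L)) * toFinAdeleGL L 3 g) →
        ∀ (μ : Literature.NumberTheory.Automorphic.IdeleClassGroup L →ₜ* Circle) (hμ : IsConjugateSymplectic L μ), HasWeight L μ 1 →
          ∀ (a : (↥(maximalRealSubfield L))ˣ) (χ : Chi (↥(maximalRealSubfield L)) L (IsCMField.complexConj L)),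
            (∃ e : L, IsAdmissibleElement L hμ.cmType.1 e ∧
                epsOf (↥(maximalRealSubfield L)) (imagUnitSq L) L (2 * imagUnit L)⁻¹ e = locF (↥(maximalRealSubfield L)) (imagUnitSq L) a) →
              ι ∉ hμ.cmType.1 →
              ∃ θ : (omegaAtLine (↥(maximalRealSubfield L)) L (IsCMField.complexConj L) 3 e₁ (Matrix.diagonal dV)
                      (complexConj_imagUnit L) (imagUnit_ne_zero L) (imagUnit_mul_self L) (realDiagonal_isSymm L dV hdV)
                      (isUnit_det_realDiagonal L dV hdV hdV0) (realDiagonal_map L dV hdV).symm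
                      (fun a => isCompatible_chiSplittingLine L e₁ dV hdV hdV0 (toHeckeCharacter L μ)
                        (isUnitary_toHeckeCharacter L μ) ((isOscillatorChar_toHeckeCharacter_iff μ).mpr hμ)
                        (TW (↥(maximalRealSubfield L)) a) (isSymm_TW (↥(maximalRealSubfield L)) a)
                        (isUnit_det_TW (↥(maximalRealSubfield L)) a) (JW (↥(maximalRealSubfield L)) L a)
                        (JW_eq (↥(maximalRealSubfield L)) L a)) a χ) →ₗ[ℂ]
                    ((adelicGroupData (↥(maximalRealSubfield L)) L (IsCMField.complexConj L) 3 H).Adelic → (Fin 2 → ℂ)),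
                θ ≠ 0 ∧
                (∀ w, θ w ∈ (CotangentForms.holCotForms (↥(maximalRealSubfield L)) L (IsCMField.complexConj L) 3 H
                    (cmArchSection L ι H T hT) (cmCompactFactor L ι H T hT)).map
                    (CotangentForms.conjFun (↥(maximalRealSubfield L)) L (IsCMField.complexConj L) 3 H)) ∧
                ∀ (k : ↥(finAdelic (↥(maximalRealSubfield L)) L (IsCMField.complexConj L) 3 H)) w,
                  θ (rhoAtLine (↥(maximalRealSubfield L)) L (IsCMField.complexConj L) 3 e₁ (Matrix.diagonal dV)
                      (complexConj_imagUnit L) (imagUnit_ne_zero L) (imagUnit_mul_self L) (realDiagonal_isSymm L dV hdV)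
                      (isUnit_det_realDiagonal L dV hdV hdV0) (realDiagonal_map L dV hdV).symm
                      (fun a => isCompatible_chiSplittingLine L e₁ dV hdV hdV0 (toHeckeCharacter L μ)
                        (isUnitary_toHeckeCharacter L μ) ((isOscillatorChar_toHeckeCharacter_iff μ).mpr hμ)
                        (TW (↥(maximalRealSubfield L)) a) (isSymm_TW (↥(maximalRealSubfield L)) a)
                        (isUnit_det_TW (↥(maximalRealSubfield L)) a) (JW (↥(maximalRealSubfield L)) L a)
                        (JW_eq (↥(maximalRealSubfield L)) L a)) ιV a χ k w) =
                    fun x => θ w (x * finAdelicToAdelic (↥(maximalRealSubfield L)) L (IsCMField.complexConj L) 3 H k)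

 := by
  intro L _ _ _ ι H T hT hHpos h2 n' eV dV hdV hdV0 g hg ιV hιV μ hμ hw a χ hadm hnot
  by_cases hemb : (InfinitePlace.mk ι).embedding = ι
  · exact thetaOccursInGenAntihol_caseB L ι H T hT hHpos h2 eV dV hdV hdV0 g hg ιV hιV μ hμ hw a χ hadm hemb hnot
  · exact thetaOccursInGenAntihol_caseD L ι H T hT hHpos h2 eV dV hdV hdV0 g hg ιV hιV μ hμ hw a χ hadm hemb hnot


end Summit.HodgeConjecture.HodgeConjecture.Cruxes.H413.K2E2ThetaOccursInGenAntihol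

end
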